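import Mathlib
import Summits.Ventures.PercRepro2.Defs
import Summits.Ventures.PercRepro2.Independence
import Summits.Ventures.PercRepro2.Graph
import Summits.Ventures.PercRepro2.Exploration
import Summits.Ventures.PercRepro2.Induced

/-!
# The hub model: five-mark connectivity in the class R is read off the root edges and the
inner pattern (blind cell PercRepro2, typer-1 g8; MINE2-HUB.md §2 (a), §5 (i))

Marks `o, a₁, a₂, a₃, b` are placed by an injective `μ : Mark → V`. The **class R** (`ClassR`):
every edge at a root `a₁`, `a₂` joins two marks. The **inner configuration** `innerConfig` closes
every edge at a root (`delConfig`), so the inner graph `G′ = G − {a₁, a₂}` is percolation on the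
same space. The **model graph** `modelGraph ends μ ω` on the five marks has a root pair adjacent
iff some edge between them is open (`OpenAdj`), and an inner pair (`o, a₃, b`) adjacent iff they
are connected in `G′`.

* `conn_iff_modelReachable` — **the structural lemma**: for `G ∈ R` and marks `u, v`,
  `u ↔ v` in `ω` iff `u` and `v` are reachable in the model graph. Proof by the closure lemma
  (`mem_of_conn_of_closed`): an edge of `G ∈ R` is either inner (both ends outside the roots) or a
  root edge between two marks; a root is isolated in `G′` (`eq_of_conn_inner_root`), so an inner
  connection between marks lifts to the model (`reachable_of_conn_inner`).

The model graph depends on `ω` only through the seven root-bundle states and the three inner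
connections — the hub law of MINE2-HUB.md §2 (a); the independence of the two groups and the
Bernstein expansion are the next files.
-/

namespace Summit.Ventures.PercRepro2.Hub

/-- The five marks of the five-point functional. -/
inductive Mark : Type
  | o
  | a₁
  | a₂
  | a₃
  | b
  deriving DecidableEq, Fintype

namespace Mark

/-- The two roots. -/
def IsRoot (m : Mark) : Prop := m = a₁ ∨ m = a₂

/-- Being a root is decidable. -/
instance : DecidablePred IsRoot := fun m => by unfold IsRoot; infer_instance

end Mark

variable {V : Type*} {E : Type*}

/-- The inner configuration: every edge at a root closed (`G′ = G − {a₁, a₂}`). -/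
noncomputable def innerConfig (ends : E → Sym2 V) (μ : Mark → V) (ω : Config E) : Config E :=
  delConfig ends {μ .a₁, μ .a₂} ω

/-- **Class R**: every edge at a root joins two marks. -/
def ClassR (ends : E → Sym2 V) (μ : Mark → V) : Prop :=
  ∀ e, e ∈ touches ends {μ .a₁, μ .a₂} → ∃ m m' : Mark, ends e = s(μ m, μ m')

/-- The model adjacency read off `ω`: a pair containing a root is adjacent iff some edge between
the two marks is open; an inner pair is adjacent iff the marks are connected in `G′`. -/
def modelAdj (ends : E → Sym2 V) (μ : Mark → V) (ω : Config E) (u v : Mark) : Prop :=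
  if u.IsRoot ∨ v.IsRoot then OpenAdj ends ω (μ u) (μ v)
  else Conn ends (innerConfig ends μ ω) (μ u) (μ v)

/-- The model graph on the five marks. -/
def modelGraph (ends : E → Sym2 V) (μ : Mark → V) (ω : Config E) : SimpleGraph Mark :=
  SimpleGraph.fromRel (modelAdj ends μ ω)

section Basic

variable {ends : E → Sym2 V} {μ : Mark → V} {ω : Config E}

/-- The inner configuration lies below `ω`. -/
lemma innerConfig_le : innerConfig ends μ ω ≤ ω := by
  intro e
  by_cases h : e ∈ touches ends {μ .a₁, μ .a₂}
  · rw [innerConfig, delConfig_apply_of_mem h]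
    exact Bool.false_le _
  · rw [innerConfig, delConfig_apply_of_notMem h]

/-- A root's vertex lies in the closed set of the inner configuration. -/
lemma root_mem {m : Mark} (hm : m.IsRoot) : μ m ∈ ({μ .a₁, μ .a₂} : Set V) := by
  rcases hm with h | h <;> subst h <;> simp

/-- An injective marking sends only roots into the root set. -/
lemma isRoot_of_mem (hinj : Function.Injective μ) {m : Mark}
    (h : μ m ∈ ({μ .a₁, μ .a₂} : Set V)) : m.IsRoot := by
  rcases h with h | h
  · exact Or.inl (hinj h)
  · exact Or.inr (hinj (Set.mem_singleton_iff.1 h))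

/-- A root is isolated in the inner configuration. -/
lemma eq_of_conn_inner_root {m : Mark} (hm : m.IsRoot) {x : V}
    (h : Conn ends (innerConfig ends μ ω) (μ m) x) : x = μ m := by
  have hx : x ∈ ({μ m} : Set V) := by
    refine mem_of_conn_of_closed (ends := ends) (ω := innerConfig ends μ ω) (S := {μ m}) ?_ rfl h
    intro y hy z hyz
    rw [Set.mem_singleton_iff] at hy
    subst hy
    obtain ⟨_, e, he, hends⟩ := openGraph_adj.1 hyz
    have ht : e ∈ touches ends {μ .a₁, μ .a₂} := ⟨μ m, root_mem hm, z, hends⟩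
    rw [innerConfig, delConfig_apply_of_mem ht] at he
    exact absurd he Bool.false_ne_true
  exact Set.mem_singleton_iff.1 hx

/-- A model adjacency gives a connection in `ω`. -/
lemma conn_of_modelAdj {u v : Mark} (h : modelAdj ends μ ω u v) : Conn ends ω (μ u) (μ v) := by
  unfold modelAdj at h
  split_ifs at h with hr
  · exact conn_of_openAdj h
  · exact conn_mono innerConfig_le h

/-- A model edge gives a connection in `ω`. -/
lemma conn_of_modelGraph_adj {u v : Mark} (h : (modelGraph ends μ ω).Adj u v) :
    Conn ends ω (μ u) (μ v) := by
  rw [modelGraph, SimpleGraph.fromRel_adj] at h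
  rcases h.2 with h' | h'
  · exact conn_of_modelAdj h'
  · exact conn_symm (conn_of_modelAdj h')

/-- **Inner connections between marks lift to the model**: if `u` reaches `m` in the model and
`m ↔ m′` in `G′`, then `u` reaches `m′`. -/
lemma reachable_of_conn_inner (hinj : Function.Injective μ) {u m m' : Mark}
    (hm : (modelGraph ends μ ω).Reachable u m)
    (h : Conn ends (innerConfig ends μ ω) (μ m) (μ m')) :
    (modelGraph ends μ ω).Reachable u m' := by
  by_cases hmm : m = m'
  · subst hmm
    exact hm
  by_cases hr : m.IsRoot
  · exact absurd (hinj (eq_of_conn_inner_root hr h)).symm hmm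
  by_cases hr' : m'.IsRoot
  · exact absurd (hinj (eq_of_conn_inner_root hr' (conn_symm h))) hmm
  have hadj : (modelGraph ends μ ω).Adj m m' := by
    rw [modelGraph, SimpleGraph.fromRel_adj]
    refine ⟨hmm, Or.inl ?_⟩
    unfold modelAdj
    rw [if_neg (not_or.2 ⟨hr, hr'⟩)]
    exact h
  exact hm.trans hadj.reachable

/-- **Open root edges lift to the model**: if `u` reaches `m` and an open edge joins the marks
`m`, `m′`, one of them a root, then `u` reaches `m′`. -/
lemma reachable_of_openAdj {u m m' : Mark} (hm : (modelGraph ends μ ω).Reachable u m)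
    (hr : m.IsRoot ∨ m'.IsRoot) (h : OpenAdj ends ω (μ m) (μ m')) :
    (modelGraph ends μ ω).Reachable u m' := by
  by_cases hmm : m = m'
  · subst hmm
    exact hm
  have hadj : (modelGraph ends μ ω).Adj m m' := by
    rw [modelGraph, SimpleGraph.fromRel_adj]
    refine ⟨hmm, Or.inl ?_⟩
    unfold modelAdj
    rw [if_pos hr]
    exact h
  exact hm.trans hadj.reachable

end Basic

section Structural

variable {ends : E → Sym2 V} {μ : Mark → V} {ω : Config E}

/-- Reachability in the model gives a connection in `ω`. -/
theorem conn_of_modelReachable {u v : Mark} (h : (modelGraph ends μ ω).Reachable u v) :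
    Conn ends ω (μ u) (μ v) := by
  rw [SimpleGraph.reachable_iff_reflTransGen] at h
  induction h with
  | refl => exact conn_refl _ _ _
  | tail _ hadj ih => exact conn_trans ih (conn_of_modelGraph_adj hadj)

/-- **The structural lemma** (MINE2-HUB.md §2 (a)): in the class R, two marks are connected in
`ω` iff they are reachable in the model graph read off the root edges and the inner pattern. -/
theorem conn_iff_modelReachable (hinj : Function.Injective μ) (hR : ClassR ends μ) (u v : Mark) :
    Conn ends ω (μ u) (μ v) ↔ (modelGraph ends μ ω).Reachable u v := by
  refine ⟨fun h => ?_, conn_of_modelReachable⟩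
  -- the set of vertices reached from `u` through the model: a mark `m` reached in the model,
  -- then an inner connection
  have key : μ v ∈ {x | ∃ m : Mark, (modelGraph ends μ ω).Reachable u m ∧
      Conn ends (innerConfig ends μ ω) (μ m) x} := by
    refine mem_of_conn_of_closed (ends := ends) (ω := ω) ?_
      ⟨u, SimpleGraph.Reachable.refl u, conn_refl _ _ _⟩ h
    rintro x ⟨m, hm, hmx⟩ y hxy
    obtain ⟨_, e, he, hends⟩ := openGraph_adj.1 hxy
    by_cases ht : e ∈ touches ends {μ .a₁, μ .a₂}
    · -- a root edge: both endpoints are marks, one of them a root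
      obtain ⟨m₁, m₂, hm12⟩ := hR e ht
      have hroot : m₁.IsRoot ∨ m₂.IsRoot := by
        obtain ⟨z, hz, w, hzw⟩ := ht
        rw [hm12, Sym2.eq_iff] at hzw
        rcases hzw with ⟨h1, _⟩ | ⟨_, h2⟩
        · exact Or.inl (isRoot_of_mem hinj (h1 ▸ hz))
        · exact Or.inr (isRoot_of_mem hinj (h2 ▸ hz))
      rw [hends, Sym2.eq_iff] at hm12
      rcases hm12 with ⟨hx, hy⟩ | ⟨hx, hy⟩
      · subst hx
        subst hy
        have h1 := reachable_of_conn_inner hinj hm hmx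
        exact ⟨m₂, reachable_of_openAdj h1 hroot ⟨e, he, hends⟩, conn_refl _ _ _⟩
      · subst hx
        subst hy
        have h1 := reachable_of_conn_inner hinj hm hmx
        refine ⟨m₁, reachable_of_openAdj h1 hroot.symm ⟨e, he, ?_⟩, conn_refl _ _ _⟩
        rw [hends, Sym2.eq_swap]
    · -- an inner edge: it stays open in `G′`
      have he' : innerConfig ends μ ω e = true := by
        rw [innerConfig, delConfig_apply_of_notMem ht]
        exact he
      exact ⟨m, hm, conn_trans hmx (conn_of_openAdj ⟨e, he', hends⟩)⟩
  obtain ⟨m, hm, hmv⟩ := key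
  exact reachable_of_conn_inner hinj hm hmv

end Structural

end Summit.Ventures.PercRepro2.Hub
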